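import Mathlib
import Summits.Ventures.PercRepro2.Defs
import Summits.Ventures.PercRepro2.Graph
import Summits.Ventures.PercRepro2.DisagreementPinned
import Summits.Ventures.PercRepro2.TypedA3Inactive
import Summits.Ventures.PercRepro2.TypedSpectator
import Summits.Ventures.PercRepro2.TypedSwitchingPrimed
import Summits.Ventures.PercRepro2.TypedSignSpectator
import Summits.Ventures.PercRepro2.OneColourSwitch
import Summits.Ventures.PercRepro2.OneColourSwitchFibre
import Summits.Ventures.PercRepro2.M9PendantFibreSign
import Summits.Ventures.PercRepro2.TypedM9Pendant
import Summits.Ventures.PercRepro2.DoubleLeafM9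

/-!
# Doubly attached marks in the typed calculus: `m9` on `(p, q, r, s)` is `m9` on `(p, q, u, w)`
(blind cell PercRepro2, p3 g16, 2026-08-27; `proofs/P3-CPNC.md` §13j (4))

If the marks `r`, `s` are attached to `u`, `w` by pinned double edges (`e₀ = {r, u}`, `e₁ = {s, w}`
not in `F`, `z = true`), then on every spectator copy the leaf edges are open, the real state map
`connState` agrees on the two mark quadruples, and every spectator fibre sum agrees
(`DoubleLeafM9.m9SignSumF_eq_of_double_edges`): the typed sign counts are EQUAL
(`typedCount_kerSign_connState_eq_of_double_edges`) and the move `m9` holds on `(F, z, τ)` for the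
marks `p, q, r, s` iff it holds for `p, q, u, w` (`typedCount_m9_connState_iff_of_double_edges`).
Reading: every typed instance with marks `p, q, u, w` is the restriction of a 2-separated instance
(separator `{u, w}`, doubly attached leaves `r`, `s`) with the same `m9` count — the move on the
2-separated instances is the move on all of them (§13j).  Own work on the cell's chain; std axioms.
-/

namespace Summit.Ventures.PercRepro2

namespace OneColourSwitch

open Finset Classical CovForm.PairHarris CovForm.TypedA3

variable {V : Type*} {E : Type*}
variable (ends : E → Sym2 V)

section Bridge

variable [Fintype E] [DecidableEq E]
variable {R : Type*} [Field R] [LinearOrder R] [IsStrictOrderedRing R]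

omit [Fintype E] [DecidableEq E] [Field R] [LinearOrder R] [IsStrictOrderedRing R] in
/-- With the leaf edges open, the real state map agrees on `(p, q, r, s)` and `(p, q, u, w)`. -/
lemma connState_eq_of_openEdges {p q r s u w : V} {e₀ e₁ : E} (hends₀ : ends e₀ = s(r, u))
    (hends₁ : ends e₁ = s(s, w)) {x : Config E} (hx₀ : x e₀ = true) (hx₁ : x e₁ = true) :
    connState ends p q r s x = connState ends p q u w x := by
  have hr := CutVertexM9.conn_iff_of_openEdge (ends := ends) hx₀ hends₀
  have hs := CutVertexM9.conn_iff_of_openEdge (ends := ends) hx₁ hends₁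
  have hrx : ∀ y, Conn ends x y r ↔ Conn ends x y u := fun y => by
    rw [CutVertexM9.conn_comm_iff (ends := ends) (ω := x), hr y,
      CutVertexM9.conn_comm_iff (ends := ends) (ω := x)]
  have hsx : ∀ y, Conn ends x y s ↔ Conn ends x y w := fun y => by
    rw [CutVertexM9.conn_comm_iff (ends := ends) (ω := x), hs y,
      CutVertexM9.conn_comm_iff (ends := ends) (ω := x)]
  simp only [connState, hrx, hsx, hr]

omit [LinearOrder R] [IsStrictOrderedRing R] in
/-- **The typed sign counts of `m9` agree under double attachment**: with `e₀ = {r, u}`,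
`e₁ = {s, w}` pinned open (`z = true`, not in `F`), for every spectator weight `g`. -/
theorem typedCount_kerSign_connState_eq_of_double_edges (F : Finset E) (z : Config E)
    (τ : E → ℕ) (hτ : ∀ e ∈ F, τ e = 1 ∨ τ e = 2) (g : St6 → R) {p q r s u w : V} {e₀ e₁ : E}
    (h₀ : e₀ ∉ F) (hz₀ : z e₀ = true) (hends₀ : ends e₀ = s(r, u))
    (h₁ : e₁ ∉ F) (hz₁ : z e₁ = true) (hends₁ : ends e₁ = s(s, w)) :
    typedCount F z τ (kerSign (connState ends p q r s) g) =
      typedCount F z τ (kerSign (connState ends p q u w) g) := by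
  rw [typedCount_kerSign_eq_sum_spec F z τ hτ _ g, typedCount_kerSign_eq_sum_spec F z τ hτ _ g]
  refine Finset.sum_congr rfl fun x _ => ?_
  by_cases hx : ∀ e, e ∉ F → x e = z e
  · rw [if_pos hx, if_pos hx]
    have hx₀ : x e₀ = true := by rw [hx e₀ h₀, hz₀]
    have hx₁ : x e₁ = true := by rw [hx e₁ h₁, hz₁]
    rw [connState_eq_of_openEdges ends hends₀ hends₁ hx₀ hx₁,
      pinnedCount_signKer_connState, pinnedCount_signKer_connState,
      bridge_fibre_sum_eq_cast, bridge_fibre_sum_eq_cast]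
    have hf₀ : e₀ ∉ (↑(specFree F τ x) : Set E) :=
      fun h => h₀ (specFree_subset F τ x (Finset.mem_coe.1 h))
    have hf₁ : e₁ ∉ (↑(specFree F τ x) : Set E) :=
      fun h => h₁ (specFree_subset F τ x (Finset.mem_coe.1 h))
    have hp₀ : specPin F z τ x e₀ = true := by rw [specPin_of_notMem h₀, hz₀]
    have hp₁ : specPin F z τ x e₁ = true := by rw [specPin_of_notMem h₁, hz₁]
    rw [CutVertexM9.m9SignSumF_eq_of_double_edges (ends := ends) _ _ hf₀ hp₀ hends₀ hf₁ hp₁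
      hends₁]
  · rw [if_neg hx, if_neg hx]

/-- **The move `m9` is invariant under double attachment**: on `(F, z, τ)` with `g ≥ 0`, it holds
for the marks `p, q, r, s` iff it holds for `p, q, u, w`. -/
theorem typedCount_m9_connState_iff_of_double_edges (F : Finset E) (z : Config E) (τ : E → ℕ)
    (hτ : ∀ e ∈ F, τ e = 1 ∨ τ e = 2) (g : St6 → R) {p q r s u w : V} {e₀ e₁ : E}
    (h₀ : e₀ ∉ F) (hz₀ : z e₀ = true) (hends₀ : ends e₀ = s(r, u))
    (h₁ : e₁ ∉ F) (hz₁ : z e₁ = true) (hends₁ : ends e₁ = s(s, w)) :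
    (typedCount F z τ (kerM9Src (connState ends p q r s) g) ≤
        typedCount F z τ (kerM9Tgt (connState ends p q r s) g)) ↔
      (typedCount F z τ (kerM9Src (connState ends p q u w) g) ≤
        typedCount F z τ (kerM9Tgt (connState ends p q u w) g)) := by
  rw [typedCount_m9_iff_sign F z τ _ g, typedCount_m9_iff_sign F z τ _ g,
    typedCount_kerSign_connState_eq_of_double_edges ends F z τ hτ g h₀ hz₀ hends₀ h₁ hz₁ hends₁]

end Bridge

end OneColourSwitch

end Summit.Ventures.PercRepro2
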